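import Literature.MathematicalPhysics.QuantumFieldTheory.Balaban1983to89.B9Thm311ProjectionR
import Literature.MathematicalPhysics.QuantumFieldTheory.Balaban1983to89.B9Thm311Curv2Symm
import Literature.MathematicalPhysics.QuantumFieldTheory.Balaban1983to89.MatrixNorms

/-!
# `Balaban1983to89.B9Ineq369CurvatureSmallAtLettersY` — T. Bałaban, *Propagators for lattice gauge theories in a background field*, Commun. Math. Phys.
# **99** (1985) 389–434 [Balaban1985BackgroundPropagators] p. 392 (after (3.10)) and (3.69) p. 404: THE TWO HALVES OF THE CURVATURE PART `Δ′(U)` OF THE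
# HESSIAN (3.10) ARE SMALL — AT def-Y's LETTERS (`Node00.OpsYDeltaA`: Jordan insertion `jordanY`, polarised commutator part `curv2Y`), in the currency of the
# N06 knit's row 17 (`trIP 1` of `B9Thm311ReadingCoords`), for unitary-valued backgrounds (file 1∕2; file 2 = `B9Thm311PosOfPrincipalAtLettersY`: the Hessian
# bound and row 17's clause reduced to the principal part)

statement-level skeleton of published theorems with citation tags; proofs where landed; nothing here is a claim about the Yang–Mills mass gap

PDF held: `paper:balaban1985-cmp99-background-propagators` (journal page = PDF page + 388); pp. 392, 396, 404–407, 416 read by this seat (2026-08-27) in the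
held text (`lit read … --pages 4-6`, `7-10`, `16-17`, `18-20`).

THE PRINT (verbatim).  p. 392, after (3.10): *«We have written it this way because with our assumptions on the configuration U the operator Δ′ will be a
bounded, small operator, which will be treated as a small perturbation of D\*D.»*  p. 404, (3.69): *«From the formula (3.10) it follows that Δ′(U′U) is a
small perturbation itself in the sense that we have the bound |(Δ′(U′U)A′)(b)| ≤ O(1)(Mα₀ + α₁)(Lʲη)⁻²|A′|, b ∈ Ω_j (3.69) the supremum on the right-hand
side is taken over bonds belonging to one of the plaquettes containing the bond b … This bound follows from the estimates [|Re U′U(∂p) − 1| ≤ …, |Im U′U(∂p)|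
≤ …] and the estimates follow directly from the assumptions (3.35), (3.37).»*

WHY THIS FILE (cell context).  NODE 06's certificate of record (dag-n06-d, `Thm/BalabanUVNodesN06AtOpsYNuOfRecordV5E*`) derives row 17 (`t311 : B9.Thm311Printed`)
from the pin + ONE displayed clause `hΔA` = «for `U` in (3.35), `PosDefTr 1 (deltaAY x.toKIdx (parSymY _) (parBY _) (GpY _ (parSymY _)) U)`» (this seat's
`B9Thm311PosAtRecordV4.t311_of_pins_opsYOfLettersV4₁`); this lineage located what the clause owes at def-Y's letters (`B9Thm311ProjectionR`: (3.26) as forms,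
`Δ_a ≥ Δ(U)`; `B9Thm311DeltaAFrustratedWitness` ∕ `…GaugeOrbit`: FALSE without (3.35), a gauge-orbit property), recorded by ref-A as WATCH-ΔA.  Print's proof of
Thm 3.11 treats `Δ′` as a perturbation of `D\*D` (p. 392, (3.69)); `Δ(U) = D\*_U𝒦_UD_U + Δ′₂(U)` at def-Y's letters (`hessY = coCurlY ∘ jordanY ∘ curlY + curv2Y`), so
`Δ′ = D\*_U(𝒦_U − 1)D_U + Δ′₂(U)`, and this file bounds BOTH HALVES as forms: the Jordan defect by `|Re U(∂p) − 1|·HS((D_UA)(p))` per plaquette, the commutator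
part by `3·c_f²|Im U(∂p)|·Σ_{b⊂∂p}HS(A(b))` per plaquette — the two printed estimates behind (3.69), at the letters the knit keys on.  File 2 assembles them into
the Hessian bound and the reduction of `hΔA` to the principal gauge-fixed form.
PRIOR ART DECLARED.  The pub-balaban NE9 chain proved the same mechanism at ITS letters (`B9Ineq369CurvatureSmall.norm_curvForm_le` ∕ `norm_inner_curvOp_self_le`
for `B9Eq310HessianOperator.curvOp` on `B11Eq103H1Complex.BondL2K`: torus `TSite`, fibre reading `φ`, trace datum `τ`).  def-Y's letters are a different encoding
(transported lifts `trLiftY` of r03's kernels on `PBond ∕ Plaq` of the V1 torus, fibre `M_N(ℂ)` with the trace pairing `trIP`); no bridge between the two letter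
families exists in the tree, so this is the def-Y-letter twin of that mechanism, written from def-Y's definitions and this lineage's row-17 files
(`B9Thm311Curv2Symm.sum_trace_curv2Y`, `B9Thm311AdjointPairs`); nothing of the NE9 files is restated or imported.

WHAT IS PROVED (sorry-free; 0 `def`; no inequality of the paper asserted — every bound is a theorem of finite-dimensional algebra at the letters).
* §1 Hilbert–Schmidt bookkeeping at the fibre, `HS(X) := Σ_{ab}|X_{ab}|²` (written out; `= Re tr(X\*X)`, `hs_eq_re_trace`) against Mathlib's `L²`-operator norm
  `‖·‖` (scope `Matrix.Norms.L2Operator`; the tree's `MatrixNorms.sum_norm_sq_mul_col_le` is the engine): Cauchy–Schwarz `abs_re_trace_le`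
  (`|Re tr(X\*Y)| ≤ √HS(X)√HS(Y)`), `hs_conjTranspose`, `hs_mul_left_le` ∕ `hs_mul_right_le` (`HS(MX), HS(XM) ≤ |M|²HS(X)`), `hs_smul`, `hs_sub_le` ∕ `hs_add_le`,
  `hs_commY_le` (`HS(i[Y, M]) ≤ 4|M|²HS(Y)`), `hs_R_le` (`HS(VXV⁻¹) ≤ HS(X)` for `|V|, |V⁻¹| ≤ 1`), `abs_re_trace_mul_right_le` ∕ `_left_le` (`|Re tr(F\*(FE))|,
  |Re tr(F\*(EF))| ≤ |E|·HS(F)`), `abs_re_trace_commY_le` (`|Re tr(X\*·i[Y, M])| ≤ |M|(HS(X) + HS(Y))`).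
* §2 the Jordan half: `jordanY_apply_eq_add` (`𝒦_UF(p) = F(p) + ½(F(p)E + EF(p))`, `E = Re U(∂p) − 1`), ★ `re_trace_jordanY_ge`
  (`Re tr(F(p)\*𝒦_UF(p)) ≥ (1 − |Re U(∂p) − 1|)·HS(F(p))`), ★★ `trIP_jordanY_ge` (`⟨F, 𝒦_UF⟩₁ ≥ Σ_p (1 − |Re U(∂p) − 1|)·HS(F(p))`), `trIP_one_self_eq`
  (`⟨Φ, Φ⟩₁ = Σ_s HS(Φ(s))`).
* §3 the commutator half: `contractive_of_mem_unitary`, `norm_sgnY`, `hs_primeEdgeY_le` (`HS(A′(b_m)) ≤ HS(A(b_m))`, unitary transport), `abs_re_tau_le` (one term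
  of the antisymmetric double contour sum `sum_trace_curv2Y`: `|Re τ_p(A, A; l, m)| ≤ |c_f²Im U(∂p)|·(HS(A(b_l)) + HS(A(b_m)))`), `abs_re_eps_mul_le`, ★★★
  **`abs_trIP_curv2Y_le`**: `|⟨A, Δ′₂(U)A⟩₁| ≤ 3·Σ_p |c_f²·Im U(∂p)|·Σ_{m<4} HS(A(b_m(p)))` at every unitary-valued background; `norm_weight_eq`
  (`|c_f²·Im U(∂p)| = c_f²·|Im U(∂p)|`).
MODEL ∕ DECLARED READINGS.  (M1) def-Y's letters at a k-level index `i` (`Node00.OpsYDeltaA`), fibre `M_N(ℂ)` with the trace pairing `trIP` (weight `1`) and Mathlib's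
`L²`-operator norm (print's `|·|`, [Balaban1985Averaging] (19) p. 21); `c_f = i.cf` is the member's difference-quotient factor, so print's `η⁻²Im U(∂p)` is def-Y's
`c_f²·Im U(∂p)`.  (M2) the only hypothesis is `U` unitary-valued (for §3; §2 holds for every `U`).  (M3) the constant `3` (= ½·Σ_{l≠m}/pairs) is this file's witness
for print's `O(1)`.  (M4) NOT HERE (file 2): the incidence count, `|U(∂p) − 1| ≤ δ ⇒ |Re U(∂p) − 1|, |Im U(∂p)| ≤ δ`, the Hessian bound, the reduction of `hΔA`;
NOT ANYWHERE in this pair: the sup-norm (pointwise) form of (3.69), `(3.35) ⇒ δ`, the coercivity of the principal form (Thm 3.3 ∕ [4]), `Δ′(U′U) − Δ′(U)`.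
HONEST SCOPE.  [folklore]-level finite-dimensional bookkeeping realising the two estimates behind p. 392 ∕ (3.69) at the letters of record; nothing of [B9]
asserted; NOT a node discharge, NOT summit progress; count-neutral; nothing continuum ∕ OS ∕ mass gap ∕ Clay.  Cell `pub-ymgap` (HUMAN RULING D-0062), Track A
node N06 [B9], seat `pub-ymgap-dag-n06-j` (bundle F5 rows 15–17; harness re-seat gen 11), 2026-08-27; dag-lead g9 DEDUP GO (7).  NEW file importing this lineage's
`B9Thm311ProjectionR` + `B9Thm311Curv2Symm` and the tree's `MatrixNorms`; nothing landed is modified.  Net new unproved facts: 0.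
-/

noncomputable section

namespace Literature.MathematicalPhysics.QuantumFieldTheory.Balaban1983to89.B9Ineq369CurvatureSmallAtLettersY

open Literature.MathematicalPhysics.QuantumFieldTheory.Balaban1983to89
open B9Thm311ReadingCoords B9Thm311AdjointAtLetters B9Thm311DeltaPrimeSymm B9Thm311DeltaPrimePos B9Thm311AdjointPairs B9Thm311Curv2Symm
  B9Thm311ProjectionR B9Ineq349SiteAdjoint Node00
open B6KLevelCensusIndexV1
open scoped Matrix

/-! ## §1 Hilbert–Schmidt bookkeeping at the fibre `M_N(ℂ)`: `HS(X) = Σ_{ab} |X_{ab}|² = Re tr(X\*X)` against the operator norm -/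

section HS

open scoped Matrix.Norms.L2Operator

variable {N : ℕ}

/-- `Σ_{ab}|X_{ab}|² = Re tr(X\*X)`. [cite: Balaban1985Averaging, (17) p.20 (‖X‖² = tr X\*X), bookkeeping] -/
theorem hs_eq_re_trace (X : Matrix (Fin N) (Fin N) ℂ) : ∑ a, ∑ b, ‖X a b‖ ^ 2 = (Matrix.trace (Xᴴ * X)).re :=
  MatrixNorms.sum_norm_sq_eq_re_trace X

/-- `HS(X) ≥ 0`. [cite: Balaban1985Averaging, (17) p.20, bookkeeping] -/
theorem hs_nonneg (X : Matrix (Fin N) (Fin N) ℂ) : 0 ≤ ∑ a, ∑ b, ‖X a b‖ ^ 2 :=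
  Finset.sum_nonneg fun _ _ => Finset.sum_nonneg fun _ _ => sq_nonneg _

/-- CAUCHY–SCHWARZ for the trace pairing against the Hilbert–Schmidt sums: `|Re tr(X\*Y)| ≤ √HS(X)·√HS(Y)`.
[cite: Balaban1985Averaging, (17)–(20) pp.20–21, bookkeeping] -/
theorem abs_re_trace_le (X Y : Matrix (Fin N) (Fin N) ℂ) :
    |(Matrix.trace (Xᴴ * Y)).re| ≤ Real.sqrt (∑ a, ∑ b, ‖X a b‖ ^ 2) * Real.sqrt (∑ a, ∑ b, ‖Y a b‖ ^ 2) := by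
  have hre : (Matrix.trace (Xᴴ * Y)).re = ∑ a, ∑ b, (star (X a b) * Y a b).re := by
    rw [Matrix.trace, Complex.re_sum, Finset.sum_comm]
    refine Finset.sum_congr rfl fun b _ => ?_
    rw [Matrix.diag_apply, Matrix.mul_apply, Complex.re_sum]
    refine Finset.sum_congr rfl fun a _ => ?_
    rw [Matrix.conjTranspose_apply]
  have h1 : |(Matrix.trace (Xᴴ * Y)).re| ≤ ∑ a, ∑ b, ‖X a b‖ * ‖Y a b‖ := by
    rw [hre]
    refine (Finset.abs_sum_le_sum_abs _ _).trans (Finset.sum_le_sum fun a _ => ?_)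
    refine (Finset.abs_sum_le_sum_abs _ _).trans (Finset.sum_le_sum fun b _ => ?_)
    calc |(star (X a b) * Y a b).re| ≤ ‖star (X a b) * Y a b‖ := Complex.abs_re_le_norm _
      _ = ‖X a b‖ * ‖Y a b‖ := by rw [norm_mul, norm_star]
  have h2 : (∑ a, ∑ b, ‖X a b‖ * ‖Y a b‖) ^ 2 ≤ (∑ a, ∑ b, ‖X a b‖ ^ 2) * (∑ a, ∑ b, ‖Y a b‖ ^ 2) := by
    rw [← Fintype.sum_prod_type' (fun a b => ‖X a b‖ * ‖Y a b‖), ← Fintype.sum_prod_type' (fun a b => ‖X a b‖ ^ 2),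
      ← Fintype.sum_prod_type' (fun a b => ‖Y a b‖ ^ 2)]
    exact Finset.sum_mul_sq_le_sq_mul_sq _ _ _
  have h3 : ∑ a, ∑ b, ‖X a b‖ * ‖Y a b‖ ≤ Real.sqrt (∑ a, ∑ b, ‖X a b‖ ^ 2) * Real.sqrt (∑ a, ∑ b, ‖Y a b‖ ^ 2) := by
    rw [← Real.sqrt_mul (hs_nonneg X)]
    exact Real.le_sqrt_of_sq_le h2
  exact h1.trans h3

/-- `HS(X\*) = HS(X)`. [cite: Balaban1985Averaging, (17) p.20, bookkeeping] -/
theorem hs_conjTranspose (X : Matrix (Fin N) (Fin N) ℂ) : ∑ a, ∑ b, ‖Xᴴ a b‖ ^ 2 = ∑ a, ∑ b, ‖X a b‖ ^ 2 := by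
  simp only [Matrix.conjTranspose_apply, norm_star]
  rw [Finset.sum_comm]

/-- left multiplication by `M` costs the OPERATOR norm: `HS(MX) ≤ |M|²·HS(X)` (the mixed inequality `‖MX‖ ≤ |M|‖X‖` of the tree's `MatrixNorms`).
[cite: Balaban1985Averaging, (20) p.21] -/
theorem hs_mul_left_le (M X : Matrix (Fin N) (Fin N) ℂ) : ∑ a, ∑ b, ‖(M * X) a b‖ ^ 2 ≤ ‖M‖ ^ 2 * ∑ a, ∑ b, ‖X a b‖ ^ 2 :=
  calc ∑ a, ∑ b, ‖(M * X) a b‖ ^ 2 = ∑ b, ∑ a, ‖(M * X) a b‖ ^ 2 := Finset.sum_comm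
    _ ≤ ∑ b, ‖M‖ ^ 2 * ∑ a, ‖X a b‖ ^ 2 := Finset.sum_le_sum fun b _ => MatrixNorms.sum_norm_sq_mul_col_le M X b
    _ = ‖M‖ ^ 2 * ∑ a, ∑ b, ‖X a b‖ ^ 2 := by rw [← Finset.mul_sum, Finset.sum_comm]

/-- right multiplication: `HS(XM) ≤ |M|²·HS(X)`. [cite: Balaban1985Averaging, (20) p.21] -/
theorem hs_mul_right_le (X M : Matrix (Fin N) (Fin N) ℂ) : ∑ a, ∑ b, ‖(X * M) a b‖ ^ 2 ≤ ‖M‖ ^ 2 * ∑ a, ∑ b, ‖X a b‖ ^ 2 := by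
  rw [← hs_conjTranspose (X * M), Matrix.conjTranspose_mul, ← hs_conjTranspose X, ← Matrix.l2_opNorm_conjTranspose M]
  exact hs_mul_left_le _ _

/-- scalars: `HS(c•X) = |c|²·HS(X)`. [cite: Balaban1985Averaging, (17) p.20, bookkeeping] -/
theorem hs_smul (c : ℂ) (X : Matrix (Fin N) (Fin N) ℂ) : ∑ a, ∑ b, ‖(c • X) a b‖ ^ 2 = ‖c‖ ^ 2 * ∑ a, ∑ b, ‖X a b‖ ^ 2 := by
  simp only [Matrix.smul_apply, smul_eq_mul, norm_mul, mul_pow, Finset.mul_sum]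

/-- `HS(X − Y) ≤ 2HS(X) + 2HS(Y)`. [cite: Balaban1985Averaging, (17) p.20, bookkeeping] -/
theorem hs_sub_le (X Y : Matrix (Fin N) (Fin N) ℂ) :
    ∑ a, ∑ b, ‖(X - Y) a b‖ ^ 2 ≤ 2 * ∑ a, ∑ b, ‖X a b‖ ^ 2 + 2 * ∑ a, ∑ b, ‖Y a b‖ ^ 2 := by
  rw [Finset.mul_sum, Finset.mul_sum, ← Finset.sum_add_distrib]
  refine Finset.sum_le_sum fun a _ => ?_
  rw [Finset.mul_sum, Finset.mul_sum, ← Finset.sum_add_distrib]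
  refine Finset.sum_le_sum fun b _ => ?_
  have h := norm_sub_le (X a b) (Y a b)
  rw [Matrix.sub_apply]
  nlinarith [sq_nonneg (‖X a b‖ - ‖Y a b‖), norm_nonneg (X a b - Y a b), norm_nonneg (X a b), norm_nonneg (Y a b)]

/-- `HS(X + Y) ≤ 2HS(X) + 2HS(Y)`. [cite: Balaban1985Averaging, (17) p.20, bookkeeping] -/
theorem hs_add_le (X Y : Matrix (Fin N) (Fin N) ℂ) :
    ∑ a, ∑ b, ‖(X + Y) a b‖ ^ 2 ≤ 2 * ∑ a, ∑ b, ‖X a b‖ ^ 2 + 2 * ∑ a, ∑ b, ‖Y a b‖ ^ 2 := by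
  have h := hs_sub_le X (-Y)
  simp only [sub_neg_eq_add, Matrix.neg_apply, norm_neg] at h
  exact h

/-- the commutator insertion `i[·, M]` of (3.10) costs `2|M|`: `HS(i[Y, M]) ≤ 4|M|²·HS(Y)`. [cite: Balaban1985BackgroundPropagators, (3.10) p.392, (3.69) p.404] -/
theorem hs_commY_le (M Y : Matrix (Fin N) (Fin N) ℂ) :
    ∑ a, ∑ b, ‖commY M Y a b‖ ^ 2 ≤ 4 * ‖M‖ ^ 2 * ∑ a, ∑ b, ‖Y a b‖ ^ 2 := by
  rw [commY_apply, hs_smul, Complex.norm_I, one_pow, one_mul]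
  have h1 := hs_mul_right_le Y M
  have h2 := hs_mul_left_le M Y
  have h3 := hs_sub_le (Y * M) (M * Y)
  nlinarith [h1, h2, h3, hs_nonneg Y, sq_nonneg ‖M‖]

/-- the adjoint action `R(V)X = VXV⁻¹` by a unit with `|V|, |V⁻¹| ≤ 1` does not increase `HS`. [cite: Balaban1985BackgroundPropagators, (3.1) p.390 (R(U)X = UXU⁻¹), (3.35) p.396] -/
theorem hs_R_le {V : (Matrix (Fin N) (Fin N) ℂ)ˣ} (hV : ‖(V : Matrix (Fin N) (Fin N) ℂ)‖ ≤ 1 ∧ ‖((V⁻¹ : (Matrix (Fin N) (Fin N) ℂ)ˣ) : Matrix (Fin N) (Fin N) ℂ)‖ ≤ 1)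
    (X : Matrix (Fin N) (Fin N) ℂ) : ∑ a, ∑ b, ‖B9Eq39Adjoint.R V X a b‖ ^ 2 ≤ ∑ a, ∑ b, ‖X a b‖ ^ 2 := by
  unfold B9Eq39Adjoint.R
  have h1 := hs_mul_right_le ((V : Matrix (Fin N) (Fin N) ℂ) * X) ((V⁻¹ : (Matrix (Fin N) (Fin N) ℂ)ˣ) : Matrix (Fin N) (Fin N) ℂ)
  have h2 := hs_mul_left_le (V : Matrix (Fin N) (Fin N) ℂ) X
  have hn1 : ‖(V : Matrix (Fin N) (Fin N) ℂ)‖ ^ 2 ≤ 1 := by nlinarith [hV.1, norm_nonneg (V : Matrix (Fin N) (Fin N) ℂ)]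
  have hn2 : ‖((V⁻¹ : (Matrix (Fin N) (Fin N) ℂ)ˣ) : Matrix (Fin N) (Fin N) ℂ)‖ ^ 2 ≤ 1 := by
    nlinarith [hV.2, norm_nonneg ((V⁻¹ : (Matrix (Fin N) (Fin N) ℂ)ˣ) : Matrix (Fin N) (Fin N) ℂ)]
  have hX := hs_nonneg X
  have hVX := hs_nonneg ((V : Matrix (Fin N) (Fin N) ℂ) * X)
  calc _ ≤ ‖((V⁻¹ : (Matrix (Fin N) (Fin N) ℂ)ˣ) : Matrix (Fin N) (Fin N) ℂ)‖ ^ 2 * ∑ a, ∑ b, ‖((V : Matrix (Fin N) (Fin N) ℂ) * X) a b‖ ^ 2 := h1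
    _ ≤ 1 * ∑ a, ∑ b, ‖((V : Matrix (Fin N) (Fin N) ℂ) * X) a b‖ ^ 2 := mul_le_mul_of_nonneg_right hn2 hVX
    _ ≤ ‖(V : Matrix (Fin N) (Fin N) ℂ)‖ ^ 2 * ∑ a, ∑ b, ‖X a b‖ ^ 2 := by rw [one_mul]; exact h2
    _ ≤ 1 * ∑ a, ∑ b, ‖X a b‖ ^ 2 := mul_le_mul_of_nonneg_right hn1 hX
    _ = _ := one_mul _

/-- `2√a√b ≤ a + b`. [folklore] -/
private theorem two_sqrt_mul_sqrt_le {a b : ℝ} (ha : 0 ≤ a) (hb : 0 ≤ b) : 2 * (Real.sqrt a * Real.sqrt b) ≤ a + b := by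
  nlinarith [sq_nonneg (Real.sqrt a - Real.sqrt b), Real.sq_sqrt ha, Real.sq_sqrt hb]

/-- the two HS-products of the Jordan defect: `|Re tr(F\*(FE))|, |Re tr(F\*(EF))| ≤ |E|·HS(F)`. [cite: Balaban1985BackgroundPropagators, (3.10) p.392, (3.69) p.404] -/
theorem abs_re_trace_mul_right_le (F E : Matrix (Fin N) (Fin N) ℂ) :
    |(Matrix.trace (Fᴴ * (F * E))).re| ≤ ‖E‖ * ∑ a, ∑ b, ‖F a b‖ ^ 2 := by
  have h := abs_re_trace_le F (F * E)
  have h2 : Real.sqrt (∑ a, ∑ b, ‖(F * E) a b‖ ^ 2) ≤ ‖E‖ * Real.sqrt (∑ a, ∑ b, ‖F a b‖ ^ 2) := by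
    rw [← Real.sqrt_sq (norm_nonneg E), ← Real.sqrt_mul (sq_nonneg _)]
    exact Real.sqrt_le_sqrt (hs_mul_right_le F E)
  calc _ ≤ Real.sqrt (∑ a, ∑ b, ‖F a b‖ ^ 2) * Real.sqrt (∑ a, ∑ b, ‖(F * E) a b‖ ^ 2) := h
    _ ≤ Real.sqrt (∑ a, ∑ b, ‖F a b‖ ^ 2) * (‖E‖ * Real.sqrt (∑ a, ∑ b, ‖F a b‖ ^ 2)) :=
        mul_le_mul_of_nonneg_left h2 (Real.sqrt_nonneg _)
    _ = ‖E‖ * ∑ a, ∑ b, ‖F a b‖ ^ 2 := by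
        rw [mul_left_comm, Real.mul_self_sqrt (hs_nonneg F)]

/-- … and on the left. [cite: Balaban1985BackgroundPropagators, (3.10) p.392, (3.69) p.404] -/
theorem abs_re_trace_mul_left_le (F E : Matrix (Fin N) (Fin N) ℂ) :
    |(Matrix.trace (Fᴴ * (E * F))).re| ≤ ‖E‖ * ∑ a, ∑ b, ‖F a b‖ ^ 2 := by
  have h := abs_re_trace_le F (E * F)
  have h2 : Real.sqrt (∑ a, ∑ b, ‖(E * F) a b‖ ^ 2) ≤ ‖E‖ * Real.sqrt (∑ a, ∑ b, ‖F a b‖ ^ 2) := by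
    rw [← Real.sqrt_sq (norm_nonneg E), ← Real.sqrt_mul (sq_nonneg _)]
    exact Real.sqrt_le_sqrt (hs_mul_left_le E F)
  calc _ ≤ Real.sqrt (∑ a, ∑ b, ‖F a b‖ ^ 2) * Real.sqrt (∑ a, ∑ b, ‖(E * F) a b‖ ^ 2) := h
    _ ≤ Real.sqrt (∑ a, ∑ b, ‖F a b‖ ^ 2) * (‖E‖ * Real.sqrt (∑ a, ∑ b, ‖F a b‖ ^ 2)) :=
        mul_le_mul_of_nonneg_left h2 (Real.sqrt_nonneg _)
    _ = ‖E‖ * ∑ a, ∑ b, ‖F a b‖ ^ 2 := by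
        rw [mul_left_comm, Real.mul_self_sqrt (hs_nonneg F)]

/-- the commutator pairing of (3.10): `|Re tr(X\* · i[Y, M])| ≤ |M|·(HS(X) + HS(Y))`. [cite: Balaban1985BackgroundPropagators, (3.10) p.392, (3.69) p.404] -/
theorem abs_re_trace_commY_le (M X Y : Matrix (Fin N) (Fin N) ℂ) :
    |(Matrix.trace (Xᴴ * commY M Y)).re| ≤ ‖M‖ * (∑ a, ∑ b, ‖X a b‖ ^ 2 + ∑ a, ∑ b, ‖Y a b‖ ^ 2) := by
  have h := abs_re_trace_le X (commY M Y)
  have h2 : Real.sqrt (∑ a, ∑ b, ‖commY M Y a b‖ ^ 2) ≤ 2 * ‖M‖ * Real.sqrt (∑ a, ∑ b, ‖Y a b‖ ^ 2) := by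
    have h4 : Real.sqrt (4 * ‖M‖ ^ 2) = 2 * ‖M‖ := by
      rw [show (4 : ℝ) * ‖M‖ ^ 2 = (2 * ‖M‖) ^ 2 by ring, Real.sqrt_sq (by positivity)]
    rw [← h4, ← Real.sqrt_mul (by positivity)]
    exact Real.sqrt_le_sqrt (hs_commY_le M Y)
  calc _ ≤ Real.sqrt (∑ a, ∑ b, ‖X a b‖ ^ 2) * Real.sqrt (∑ a, ∑ b, ‖commY M Y a b‖ ^ 2) := h
    _ ≤ Real.sqrt (∑ a, ∑ b, ‖X a b‖ ^ 2) * (2 * ‖M‖ * Real.sqrt (∑ a, ∑ b, ‖Y a b‖ ^ 2)) :=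
        mul_le_mul_of_nonneg_left h2 (Real.sqrt_nonneg _)
    _ = ‖M‖ * (2 * (Real.sqrt (∑ a, ∑ b, ‖X a b‖ ^ 2) * Real.sqrt (∑ a, ∑ b, ‖Y a b‖ ^ 2))) := by ring
    _ ≤ ‖M‖ * (∑ a, ∑ b, ‖X a b‖ ^ 2 + ∑ a, ∑ b, ‖Y a b‖ ^ 2) :=
        mul_le_mul_of_nonneg_left (two_sqrt_mul_sqrt_le (hs_nonneg X) (hs_nonneg Y)) (norm_nonneg M)

end HS

/-! ## §2 The Jordan insertion `𝒦_U` of (3.10): `Re tr(F(p)\*·𝒦_U F(p)) ≥ (1 − |Re U(∂p) − 1|)·HS(F(p))` -/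

section Jordan

open scoped Matrix.Norms.L2Operator

variable {d ℓ : ℕ} {hd : 1 ≤ d + 1} {hL : Odd (ℓ + 1) ∧ 1 < ℓ + 1} {b₀ b₁ : ℝ} {N : ℕ}
variable (i : KIdx d ℓ hd hL b₀ b₁) (U : CfgY (Matrix (Fin N) (Fin N) ℂ) i)

/-- the Jordan insertion around `Re U(∂p) = 1 + E`: `𝒦_U F(p) = F(p) + ½(F(p)E + EF(p))`. [cite: Balaban1985BackgroundPropagators, (3.7) p.391, (3.10) p.392] -/
theorem jordanY_apply_eq_add (F : PlaqY i → Matrix (Fin N) (Fin N) ℂ) (p : PlaqY i) :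
    jordanY i U F p = F p + (((1 / 2 : ℝ) : ℂ)) • (F p * (reHolY i U p - 1) + (reHolY i U p - 1) * F p) := by
  rw [jordanY_apply, show ((1 / 2 : ℂ)) = (((1 / 2 : ℝ) : ℂ)) by push_cast; ring]
  simp only [Matrix.mul_sub, Matrix.sub_mul, Matrix.mul_one, Matrix.one_mul, smul_add, smul_sub]
  module

/-- ★ per plaquette: `Re tr(F(p)\*·𝒦_U F(p)) ≥ (1 − |Re U(∂p) − 1|)·HS(F(p))` — the `Re U(∂p) − 1` half of «Δ′ is a small perturbation of D\*D».
[cite: Balaban1985BackgroundPropagators, p.392 (after (3.10)), (3.69) p.404] -/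
theorem re_trace_jordanY_ge (F : PlaqY i → Matrix (Fin N) (Fin N) ℂ) (p : PlaqY i) :
    (1 - ‖reHolY i U p - 1‖) * ∑ a, ∑ b, ‖F p a b‖ ^ 2 ≤ (Matrix.trace ((F p)ᴴ * jordanY i U F p)).re := by
  set E := reHolY i U p - 1 with hE
  have hexp : (Matrix.trace ((F p)ᴴ * jordanY i U F p)).re = ∑ a, ∑ b, ‖F p a b‖ ^ 2 +
      (1 / 2 : ℝ) * ((Matrix.trace ((F p)ᴴ * (F p * E))).re + (Matrix.trace ((F p)ᴴ * (E * F p))).re) := by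
    rw [jordanY_apply_eq_add, ← hE, Matrix.mul_add, Matrix.mul_smul, Matrix.mul_add, Matrix.trace_add, Matrix.trace_smul, Matrix.trace_add,
      Complex.add_re, smul_eq_mul, Complex.re_ofReal_mul, Complex.add_re, hs_eq_re_trace]
  have h1 := abs_re_trace_mul_right_le (F p) E
  have h2 := abs_re_trace_mul_left_le (F p) E
  rw [abs_le] at h1 h2
  rw [hexp]
  nlinarith [h1.1, h2.1]

/-- ★ summed: `⟨F, 𝒦_U F⟩₁ ≥ Σ_p (1 − |Re U(∂p) − 1|)·HS(F(p))`. [cite: Balaban1985BackgroundPropagators, p.392 (after (3.10)), (3.69) p.404] -/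
theorem trIP_jordanY_ge (F : PlaqY i → Matrix (Fin N) (Fin N) ℂ) :
    ∑ p, (1 - ‖reHolY i U p - 1‖) * ∑ a, ∑ b, ‖F p a b‖ ^ 2 ≤ trIP (fun _ => (1 : ℝ)) F (jordanY i U F) := by
  rw [trIP_one_eq, Complex.re_sum]
  exact Finset.sum_le_sum fun p _ => re_trace_jordanY_ge i U F p

/-- the weight-`1` trace norm is the sum of the fibre Hilbert–Schmidt sums: `⟨Φ, Φ⟩₁ = Σ_s HS(Φ(s))`. [cite: Balaban1985BackgroundPropagators, p.393 (scalar products), bookkeeping] -/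
theorem trIP_one_self_eq {S : Type} [Fintype S] (Φ : S → Matrix (Fin N) (Fin N) ℂ) :
    trIP (fun _ => (1 : ℝ)) Φ Φ = ∑ s, ∑ a, ∑ b, ‖Φ s a b‖ ^ 2 := by
  rw [trIP_one_eq, Complex.re_sum]
  exact Finset.sum_congr rfl fun s _ => (hs_eq_re_trace (Φ s)).symm

end Jordan

/-! ## §3 The commutator part `Δ′₂(U)`: `|⟨A, Δ′₂(U)A⟩₁| ≤ 3·Σ_p |c_f²·Im U(∂p)|·Σ_{m<4} HS(A(b_m(p)))` -/

section Commutator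

open scoped Matrix.Norms.L2Operator

variable {d ℓ : ℕ} {hd : 1 ≤ d + 1} {hL : Odd (ℓ + 1) ∧ 1 < ℓ + 1} {b₀ b₁ : ℝ} {N : ℕ}
variable (i : KIdx d ℓ hd hL b₀ b₁) (U : CfgY (Matrix (Fin N) (Fin N) ℂ) i)

/-- a unitary unit of `M_N(ℂ)` and its inverse are operator-norm contractions. [cite: Balaban1985Averaging, (19)–(20) p.21, bookkeeping] -/
theorem contractive_of_mem_unitary {V : (Matrix (Fin N) (Fin N) ℂ)ˣ} (hV : (V : Matrix (Fin N) (Fin N) ℂ) ∈ unitary (Matrix (Fin N) (Fin N) ℂ)) :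
    ‖(V : Matrix (Fin N) (Fin N) ℂ)‖ ≤ 1 ∧ ‖((V⁻¹ : (Matrix (Fin N) (Fin N) ℂ)ˣ) : Matrix (Fin N) (Fin N) ℂ)‖ ≤ 1 := by
  have hV' : V ∈ B7Prop2Explicit.unitaryUnits (Matrix (Fin N) (Fin N) ℂ) := hV
  have hVi : (((V⁻¹ : (Matrix (Fin N) (Fin N) ℂ)ˣ)) : Matrix (Fin N) (Fin N) ℂ) ∈ unitary (Matrix (Fin N) (Fin N) ℂ) :=
    (B7Prop2Explicit.unitaryUnits _).inv_mem hV'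
  rcases subsingleton_or_nontrivial (Matrix (Fin N) (Fin N) ℂ) with h | h
  · rw [Subsingleton.elim (V : Matrix (Fin N) (Fin N) ℂ) 0, Subsingleton.elim (((V⁻¹ : (Matrix (Fin N) (Fin N) ℂ)ˣ)) : Matrix (Fin N) (Fin N) ℂ) 0,
      norm_zero]
    exact ⟨zero_le_one, zero_le_one⟩
  · exact ⟨(CStarRing.norm_of_mem_unitary hV).le, (CStarRing.norm_of_mem_unitary hVi).le⟩

/-- the contour signs have modulus `1`. [cite: Balaban1985BackgroundPropagators, (3.5) p.391, bookkeeping] -/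
theorem norm_sgnY (m : Fin 4) : ‖sgnY m‖ = 1 := by
  fin_cases m <;> simp [sgnY]

/-- the primed contour variable is no larger than the variable: `HS(A′(b_m)) ≤ HS(A(b_m))` (unitary transport). [cite: Balaban1985BackgroundPropagators, (3.2) p.390, (3.69) p.404] -/
theorem hs_primeEdgeY_le (hU : ∀ μ x, ((U μ x : (Matrix (Fin N) (Fin N) ℂ)ˣ) : Matrix (Fin N) (Fin N) ℂ) ∈ unitary (Matrix (Fin N) (Fin N) ℂ))
    (p : PlaqY i) (m : Fin 4) (A : FBondY i → Matrix (Fin N) (Fin N) ℂ) :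
    ∑ a, ∑ b, ‖primeEdgeY i U p m A a b‖ ^ 2 ≤ ∑ a, ∑ b, ‖A (edgeY i p m) a b‖ ^ 2 := by
  rw [primeEdgeY_apply, hs_smul, norm_sgnY, one_pow, one_mul]
  exact hs_R_le (contractive_of_mem_unitary (edgeParY_mem_unitary i U hU p m)) _

/-- one term of the polarised commutator form: `|Re τ_p(A, A; l, m)| ≤ |c_f²·Im U(∂p)|·(HS(A(b_l)) + HS(A(b_m)))`.
[cite: Balaban1985BackgroundPropagators, (3.10) p.392, (3.69) p.404] -/
theorem abs_re_tau_le (hU : ∀ μ x, ((U μ x : (Matrix (Fin N) (Fin N) ℂ)ˣ) : Matrix (Fin N) (Fin N) ℂ) ∈ unitary (Matrix (Fin N) (Fin N) ℂ))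
    (p : PlaqY i) (A : FBondY i → Matrix (Fin N) (Fin N) ℂ) (l m : Fin 4) :
    |(tau i U p A A l m).re| ≤ ‖(((i.cf ^ 2 : ℝ)) : ℂ) • imHolY i U p‖ *
      (∑ a, ∑ b, ‖A (edgeY i p l) a b‖ ^ 2 + ∑ a, ∑ b, ‖A (edgeY i p m) a b‖ ^ 2) := by
  unfold tau
  exact (abs_re_trace_commY_le _ _ _).trans
    (mul_le_mul_of_nonneg_left (add_le_add (hs_primeEdgeY_le i U hU p l A) (hs_primeEdgeY_le i U hU p m A)) (norm_nonneg _))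

/-- the ordering sign is real, of modulus `≤ 1`, and vanishes on the diagonal: `|Re(ε(l,m)·z)| ≤ [l ≠ m]·|Re z|`. [cite: Balaban1985BackgroundPropagators, (3.10) p.392 (b₁ ≺ b₂), bookkeeping] -/
theorem abs_re_eps_mul_le (l m : Fin 4) (z : ℂ) : |(eps l m * z).re| ≤ if l = m then 0 else |z.re| := by
  by_cases hlm : l = m
  · subst hlm
    simp [eps]
  · rw [if_neg hlm]
    unfold eps
    split_ifs <;> simp

/-- the diagonal-free double sum of the pair weights: `Σ_m Σ_l [l ≠ m]·(h_l + h_m) = 6·Σ_m h_m` on `Fin 4`. [folklore] -/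
private theorem sum_sum_ite_eq (h : Fin 4 → ℝ) (c : ℝ) :
    ∑ m : Fin 4, ∑ l : Fin 4, (if l = m then 0 else c * (h l + h m)) = 6 * c * ∑ m : Fin 4, h m := by
  have h1 : ∀ m : Fin 4, ∑ l : Fin 4, (if l = m then 0 else c * (h l + h m)) = c * ∑ l : Fin 4, h l + 2 * c * h m := by
    intro m
    have h2 : ∀ l : Fin 4, (if l = m then 0 else c * (h l + h m)) = c * (h l + h m) - if l = m then c * (h l + h m) else 0 := by
      intro l; split_ifs <;> ring
    rw [Finset.sum_congr rfl fun l _ => h2 l, Finset.sum_sub_distrib, Finset.sum_ite_eq', if_pos (Finset.mem_univ m)]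
    simp only [mul_add, Finset.sum_add_distrib, Finset.sum_const, Finset.card_univ, Fintype.card_fin, nsmul_eq_mul, ← Finset.mul_sum]
    push_cast
    ring
  rw [Finset.sum_congr rfl fun m _ => h1 m, Finset.sum_add_distrib, Finset.sum_const, Finset.card_univ, Fintype.card_fin, nsmul_eq_mul,
    ← Finset.mul_sum]
  push_cast
  ring

/-- ★★ **THE COMMUTATOR PART IS SMALL**: `|⟨A, Δ′₂(U)A⟩₁| ≤ 3·Σ_p |c_f²·Im U(∂p)|·Σ_{m<4} HS(A(b_m(p)))` at every unitary-valued background — the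
`Im U(∂p)` half of «Δ′ is a small perturbation of D\*D» ∕ of (3.69), in the form currency of row 17. [cite: Balaban1985BackgroundPropagators, p.392 (after (3.10)), (3.69) p.404] -/
theorem abs_trIP_curv2Y_le (hU : ∀ μ x, ((U μ x : (Matrix (Fin N) (Fin N) ℂ)ˣ) : Matrix (Fin N) (Fin N) ℂ) ∈ unitary (Matrix (Fin N) (Fin N) ℂ))
    (A : FBondY i → Matrix (Fin N) (Fin N) ℂ) :
    |trIP (fun _ => (1 : ℝ)) A (curv2Y i U A)| ≤
      3 * ∑ p : PlaqY i, ‖(((i.cf ^ 2 : ℝ)) : ℂ) • imHolY i U p‖ * ∑ m : Fin 4, ∑ a, ∑ b, ‖A (edgeY i p m) a b‖ ^ 2 := by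
  rw [trIP_comm, trIP_one_eq, sum_trace_curv2Y i U hU A A, show (-(1 / 2 : ℂ)) = (((-(1 / 2) : ℝ)) : ℂ) by push_cast; ring,
    Complex.re_ofReal_mul, abs_mul, show |(-(1 / 2) : ℝ)| = 1 / 2 by norm_num, Complex.re_sum]
  have key : ∀ p : PlaqY i, |(∑ m : Fin 4, ∑ l : Fin 4, eps l m * tau i U p A A l m).re| ≤
      6 * ‖(((i.cf ^ 2 : ℝ)) : ℂ) • imHolY i U p‖ * ∑ m : Fin 4, ∑ a, ∑ b, ‖A (edgeY i p m) a b‖ ^ 2 := by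
    intro p
    rw [← sum_sum_ite_eq (fun m => ∑ a, ∑ b, ‖A (edgeY i p m) a b‖ ^ 2) ‖(((i.cf ^ 2 : ℝ)) : ℂ) • imHolY i U p‖, Complex.re_sum]
    refine (Finset.abs_sum_le_sum_abs _ _).trans (Finset.sum_le_sum fun m _ => ?_)
    rw [Complex.re_sum]
    refine (Finset.abs_sum_le_sum_abs _ _).trans (Finset.sum_le_sum fun l _ => ?_)
    refine (abs_re_eps_mul_le l m _).trans ?_
    split_ifs with hlm
    · exact le_rfl
    · exact abs_re_tau_le i U hU p A l m
  calc 1 / 2 * |∑ p : PlaqY i, (∑ m : Fin 4, ∑ l : Fin 4, eps l m * tau i U p A A l m).re|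
      ≤ 1 / 2 * ∑ p : PlaqY i, 6 * ‖(((i.cf ^ 2 : ℝ)) : ℂ) • imHolY i U p‖ * ∑ m : Fin 4, ∑ a, ∑ b, ‖A (edgeY i p m) a b‖ ^ 2 :=
        mul_le_mul_of_nonneg_left ((Finset.abs_sum_le_sum_abs _ _).trans (Finset.sum_le_sum fun p _ => key p)) (by norm_num)
    _ = _ := by rw [Finset.mul_sum, Finset.mul_sum]; exact Finset.sum_congr rfl fun p _ => by ring

/-- the weight in lattice units: `|c_f²·Im U(∂p)| = c_f²·|Im U(∂p)|`. [cite: Balaban1985BackgroundPropagators, (3.10) p.392 (η⁻² Im U(∂p)), bookkeeping] -/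
theorem norm_weight_eq (p : PlaqY i) : ‖(((i.cf ^ 2 : ℝ)) : ℂ) • imHolY i U p‖ = i.cf ^ 2 * ‖imHolY i U p‖ := by
  rw [norm_smul, Complex.norm_real, Real.norm_eq_abs, abs_of_nonneg (sq_nonneg _)]

end Commutator

end Literature.MathematicalPhysics.QuantumFieldTheory.Balaban1983to89.B9Ineq369CurvatureSmallAtLettersY
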